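import Summits.MatrixMultiplication.OmegaCensus.STPP222CubeClauses
import Mathlib.Algebra.BigOperators.Group.Finset.Basic
import Mathlib.Tactic.IntervalCases

/-!
# ω-census, the pattern `(2,2,2)³`: reflection II — validity of the linear clause forms, engine lemmas

HONEST FRAMING (pub-omega census; verbatim): lottery ticket; floor = certified bounds/negative ranges.
Census STRUCTURE bookkeeping (question Q7, row `k = 3`: the lower half `n₃ ≥ 32`), not progress on `ω`.

Second reflection file: the LINEAR EXPANSION of a Def-5.1 word over the 13 variables (`lsum_eq_sum`), the decidable
VALIDITY `linValid` / `levelValid` of a linear form against an index tuple and its consequence `gword_of_valid`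
(the word is `±v + (Σ plus − Σ minus)`), and the engine-side lemmas: `sumGet`, `linForb` (`linForb_eq`: the forbidden
code is the code of `∓(Σ plus − Σ minus)`), `linMask` (`of_testBit_linMask`), agreement of partial configurations.

References: H. Cohn, R. Kleinberg, B. Szegedy, C. Umans, FOCS 2005 (arXiv:math/0511460), Def. 5.1.
Record: pub-omega HOME `pub-omega-eng2/results/c4red/K2-THRESHOLD-eng2.md` §NEG3 (ENG2 gen 18, 2026-08-23).
-/

open Literature.Computability.AlgebraicComplexity Finset

namespace Summit.MatrixMultiplication.OmegaCensus

namespace STPP222CubeNeg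

/-! ## 3. Linear expansion of words and validity of the linear forms -/

/-- Position of a variable in the search order. -/
def V13.idx : V13 → ℕ
  | .a0 => 0 | .b0 => 1 | .c0 => 2 | .q1 => 3 | .r1 => 4 | .q1' => 5 | .r1' => 6 | .a1 => 7 | .q2 => 8 | .r2 => 9
  | .q2' => 10 | .r2' => 11 | .a2 => 12

/-- All variables, in search order. -/
def allV : List V13 := [.a0, .b0, .c0, .q1, .r1, .q1', .r1', .a1, .q2, .r2, .q2', .r2', .a2]

/-- Every variable is listed. -/
theorem mem_allV (u : V13) : u ∈ allV := by cases u <;> simp [allV]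

/-- The six signed entries of the word of an index tuple (`true` = `+`): `+A i es'`, `−A k es`, `+B j et'`, `−B i et`,
`+C k eu'`, `−C j eu`. -/
def sslots (ι : Idx3) : List (Option V13 × Bool) :=
  [(slotA ι.i ι.es', true), (slotA ι.k ι.es, false), (slotB ι.j ι.et', true), (slotB ι.i ι.et, false),
   (slotC ι.k ι.eu', true), (slotC ι.j ι.eu, false)]

/-- Signed value. -/
def sgv {G : Type} [AddCommGroup G] (σ : Bool) (x : G) : G := if σ then x else -x

/-- Signed sum of a list of signed optional variables. -/
def lsum {G : Type} [AddCommGroup G] (val : V13 → G) (S : List (Option V13 × Bool)) : G :=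
  S.foldr (fun p acc => sgv p.2 (oval val p.1) + acc) 0

/-- Integer coefficient of a variable in a list of signed optional variables. -/
def coefZ (S : List (Option V13 × Bool)) (u : V13) : ℤ :=
  S.foldr (fun p acc => (if p.1 = some u then (if p.2 then 1 else -1) else 0) + acc) 0

/-- The word is the signed sum of its six signed entries. -/
theorem gword_eq_lsum {G : Type} [AddCommGroup G] (val : V13 → G) (ι : Idx3) :
    gword val ι = lsum val (sslots ι) := by
  simp only [gword, gA, gB, gC, lsum, sslots, List.foldr_cons, List.foldr_nil, sgv, Bool.false_eq_true, ite_false,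
    ite_true, add_zero, sub_eq_add_neg]
  abel

/-- LINEAR EXPANSION: a signed sum is the coefficient-weighted sum over all variables. -/
theorem lsum_eq_sum {G : Type} [AddCommGroup G] (val : V13 → G) (S : List (Option V13 × Bool)) :
    lsum val S = ∑ u ∈ allV.toFinset, coefZ S u • val u := by
  induction S with
  | nil => simp [lsum, coefZ]
  | cons p S ih =>
    obtain ⟨s, σ⟩ := p
    have hl : lsum val ((s, σ) :: S) = sgv σ (oval val s) + lsum val S := rfl
    have hc : ∀ u, coefZ ((s, σ) :: S) u = (if s = some u then (if σ then 1 else -1) else 0) + coefZ S u :=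
      fun u => rfl
    rw [hl, ih]
    simp only [hc, add_zsmul, Finset.sum_add_distrib]
    congr 1
    cases s with
    | none => simp [oval, sgv]
    | some u₀ =>
      have hmem : u₀ ∈ allV.toFinset := by simp [mem_allV]
      simp only [Option.some.injEq, oval]
      rw [Finset.sum_eq_single u₀]
      · cases σ <;> simp [sgv]
      · intro u _ hne; simp [Ne.symm hne]
      · intro h; exact absurd hmem h

/-- List sums are count-weighted sums over all variables. -/
theorem sum_map_eq_sum {G : Type} [AddCommGroup G] (val : V13 → G) (l : List V13) :
    (l.map val).sum = ∑ u ∈ allV.toFinset, (l.count u : ℤ) • val u := by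
  induction l with
  | nil => simp
  | cons v l ih =>
    rw [List.map_cons, List.sum_cons, ih]
    have hmem : v ∈ allV.toFinset := by simp [mem_allV]
    have hc : ∀ u, ((List.count u (v :: l) : ℕ) : ℤ) = (if u = v then 1 else 0) + (l.count u : ℤ) := by
      intro u
      rw [List.count_cons]
      by_cases h : u = v
      · subst h; simp; ring
      · simp [h, beq_eq_decide, Ne.symm h]
    simp only [hc, add_zsmul, Finset.sum_add_distrib]
    congr 1
    rw [Finset.sum_eq_single v]
    · simp
    · intro u _ hne; simp [hne]
    · intro h; exact absurd hmem h

/-- VALIDITY of a linear form `l` for index tuple `ι` at position `p` (decidable): the conclusion of `ι` fails; the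
coefficient of the position's variable `v` in the word of `ι` is `+1`/`−1` as `l.pos`; every other variable has
coefficient `count plus − count minus`; `plus`, `minus` only contain earlier variables, have at most six entries, and
`nm = minus.length`. -/
def linValid (p : ℕ) (ι : Idx3) (l : LinCl) : Bool :=
  match allV[p]? with
  | none => false
  | some v =>
    !ι.concl && (coefZ (sslots ι) v == (if l.pos then 1 else -1)) &&
    (allV.all fun u => u == v || (coefZ (sslots ι) u == (l.plus.count u : ℤ) - (l.minus.count u : ℤ))) &&
    ((l.plus ++ l.minus).all fun u => decide (u.idx < p)) && (l.nm == l.minus.length) &&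
    decide (l.plus.length ≤ 6) && decide (l.minus.length ≤ 6)

/-- Validity of a level: index tuples and linear forms correspond one to one. -/
def levelValid (p : ℕ) : List Idx3 → List LinCl → Bool
  | [], [] => true
  | ι :: L, l :: K => linValid p ι l && levelValid p L K
  | _, _ => false

/-- A valid level provides a valid index tuple for every linear form. -/
theorem exists_valid_of_mem {p : ℕ} {L : List Idx3} {K : List LinCl} (h : levelValid p L K = true) {l : LinCl}
    (hl : l ∈ K) : ∃ ι, linValid p ι l = true := by
  induction K generalizing L with
  | nil => simp at hl
  | cons l' K ih =>
    cases L with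
    | nil => simp [levelValid] at h
    | cons ι L =>
      simp only [levelValid, Bool.and_eq_true] at h
      rcases List.mem_cons.1 hl with rfl | hl
      · exact ⟨ι, h.1⟩
      · exact ih h.2 hl

/-- Position `p` holds variable `allV[p]`. -/
theorem idx_of_getElem? {p : ℕ} {v : V13} (h : allV[p]? = some v) : v.idx = p := by
  have hp : p < allV.length := by
    by_contra hc
    rw [List.getElem?_eq_none (Nat.le_of_not_lt hc)] at h
    cases h
  simp only [allV, List.length_cons, List.length_nil] at hp
  interval_cases p <;> simp [allV] at h <;> subst h <;> rfl

/-- CONSEQUENCE OF VALIDITY: the word of `ι` is `± (value of the position's variable) + (Σ plus − Σ minus)`. -/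
theorem gword_of_valid {G : Type} [AddCommGroup G] {p : ℕ} {ι : Idx3} {l : LinCl} (h : linValid p ι l = true)
    {v : V13} (hv : allV[p]? = some v) (val : V13 → G) :
    gword val ι = sgv l.pos (val v) + ((l.plus.map val).sum - (l.minus.map val).sum) := by
  simp only [linValid, hv, Bool.and_eq_true, Bool.not_eq_true', beq_iff_eq, List.all_eq_true, Bool.or_eq_true,
    decide_eq_true_eq] at h
  obtain ⟨⟨⟨⟨⟨⟨_, hcv⟩, hcu⟩, hlt⟩, _⟩, _⟩, _⟩ := h
  have hvp := idx_of_getElem? hv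
  have hv_plus : l.plus.count v = 0 := List.count_eq_zero.2 fun hm => by
    have := hlt v (List.mem_append.2 (.inl hm)); omega
  have hv_minus : l.minus.count v = 0 := List.count_eq_zero.2 fun hm => by
    have := hlt v (List.mem_append.2 (.inr hm)); omega
  rw [gword_eq_lsum, lsum_eq_sum, sum_map_eq_sum, sum_map_eq_sum, ← Finset.sum_sub_distrib]
  have hsgv : sgv l.pos (val v) = ∑ u ∈ allV.toFinset, (if u = v then (if l.pos then (1 : ℤ) else -1) else 0) • val u := by
    rw [Finset.sum_eq_single v]
    · cases l.pos <;> simp [sgv]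
    · intro u _ hne; simp [hne]
    · intro hn; exact absurd (by simp [mem_allV]) hn
  rw [hsgv, ← Finset.sum_add_distrib]
  refine Finset.sum_congr rfl fun u _ => ?_
  rw [show ∀ a b c : ℤ, a • val u + (b • val u - c • val u) = (a + (b - c)) • val u from
    fun a b c => by simp only [add_zsmul, sub_eq_add_neg, neg_zsmul]]
  congr 1
  by_cases hu : u = v
  · subst hu; rw [hcv, hv_plus, hv_minus]; simp
  · have := hcu u (mem_allV u)
    rcases this with h | h
    · exact absurd h hu
    · rw [h]; simp [hu]

/-! ## 4. The engine computes codes of group values -/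

/-- Reading a set entry. -/
theorem Cfg3.get_set (P : Cfg3) (v u : V13) (x : ℕ) : (P.set v x).get u = if u = v then x else P.get u := by
  cases v <;> cases u <;> rfl

/-- The full code configuration of an assignment. -/
def cfgOf {G : Type} [AddCommGroup G] (E : Enc3 G) (val : V13 → G) : Cfg3 :=
  ⟨E.enc (val .a0), E.enc (val .b0), E.enc (val .c0), E.enc (val .q1), E.enc (val .r1), E.enc (val .q1'),
    E.enc (val .r1'), E.enc (val .a1), E.enc (val .q2), E.enc (val .r2), E.enc (val .q2'), E.enc (val .r2'),
    E.enc (val .a2)⟩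

/-- Entries of the full code configuration. -/
theorem cfgOf_get {G : Type} [AddCommGroup G] (E : Enc3 G) (val : V13 → G) (u : V13) :
    (cfgOf E val).get u = E.enc (val u) := by
  cases u <;> rfl

/-- A partial configuration AGREES with the assignment below position `p`. -/
def Agrees {G : Type} [AddCommGroup G] (E : Enc3 G) (val : V13 → G) (P : Cfg3) (p : ℕ) : Prop :=
  ∀ u : V13, u.idx < p → P.get u = E.enc (val u)

/-- Agreement extends by setting the position's variable to its code. -/
theorem agrees_set {G : Type} [AddCommGroup G] (E : Enc3 G) (val : V13 → G) {P : Cfg3} {p : ℕ}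
    (h : Agrees E val P p) {v : V13} (hv : v.idx = p) : Agrees E val (P.set v (E.enc (val v))) (p + 1) := by
  intro u hu
  rw [Cfg3.get_set]
  by_cases huv : u = v
  · subst huv; simp
  · rw [if_neg huv]
    have : u.idx ≠ v.idx := fun e => huv (by cases u <;> cases v <;> first | rfl | exact absurd e (by decide))
    exact h u (by omega)

/-- `sumGet` unfolds. -/
theorem sumGet_cons (P : Cfg3) (v : V13) (l : List V13) (init : ℕ) :
    sumGet P (v :: l) init = sumGet P l (init + P.get v) := rfl

/-- `sumGet` adds the codes of the listed variables. -/
theorem sumGet_eq {G : Type} [AddCommGroup G] (E : Enc3 G) (val : V13 → G) (P : Cfg3) (l : List V13)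
    (h : ∀ u ∈ l, P.get u = E.enc (val u)) (init : ℕ) :
    sumGet P l init = init + ((l.map val).map E.enc).sum := by
  induction l generalizing init with
  | nil => rfl
  | cons v l ih =>
    rw [sumGet_cons, ih (fun u hu => h u (List.mem_cons_of_mem _ hu)), h v (by simp)]
    simp [Nat.add_assoc]

/-- THE FORBIDDEN CODE of a valid linear form, on an agreeing configuration, is the code of `∓(Σ plus − Σ minus)`. -/
theorem linForb_eq {G : Type} [AddCommGroup G] (E : Enc3 G) (val : V13 → G) {P : Cfg3} {l : LinCl}
    (hag : ∀ u ∈ l.plus ++ l.minus, P.get u = E.enc (val u)) (hnm : l.nm = l.minus.length)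
    (hp6 : l.plus.length ≤ 6) (hm6 : l.minus.length ≤ 6) :
    linForb E.A P l = E.enc (sgv (!l.pos) ((l.plus.map val).sum - (l.minus.map val).sum)) := by
  have hP : sumGet P l.plus (Nat.mul E.A.off l.nm) = E.A.off * (l.minus.map val).length + ((l.plus.map val).map E.enc).sum := by
    rw [sumGet_eq E val P l.plus (fun u hu => hag u (List.mem_append.2 (.inl hu))), hnm, List.length_map]; rfl
  have hM : sumGet P l.minus 0 = ((l.minus.map val).map E.enc).sum := by
    rw [sumGet_eq E val P l.minus (fun u hu => hag u (List.mem_append.2 (.inr hu))), Nat.zero_add]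
  have hred : E.A.reduce (sumRep E.A P l) = E.enc ((l.plus.map val).sum - (l.minus.map val).sum) := by
    unfold sumRep
    rw [hP, hM]
    exact E.reduce_sum (l.plus.map val) (l.minus.map val) (by simpa using hp6) (by simpa using hm6)
  unfold linForb
  cases hpos : l.pos
  · simp only [hred, sgv, Bool.not_false, if_true]
  · simp only [hred, E.neg_enc, sgv, Bool.not_true]; rfl

/-- `linMask` unfolds. -/
theorem linMask_cons (A : Arith) (P : Cfg3) (l : LinCl) (K : List LinCl) (m₀ : ℕ) :
    linMask A P (l :: K) m₀ = linMask A P K (m₀ ||| (1 <<< linForb A P l)) := rfl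

/-- A set bit of a mask comes from `m₀` or from the forbidden code of a listed form. -/
theorem of_testBit_linMask (A : Arith) (P : Cfg3) (K : List LinCl) (m₀ x : ℕ)
    (h : (linMask A P K m₀).testBit x = true) : m₀.testBit x = true ∨ ∃ l ∈ K, linForb A P l = x := by
  induction K generalizing m₀ with
  | nil => exact .inl h
  | cons l K ih =>
    rw [linMask_cons] at h
    rcases ih _ h with h | ⟨l', hl', he⟩
    · rw [Nat.testBit_lor, Bool.or_eq_true, Nat.one_shiftLeft, Nat.testBit_two_pow] at h
      rcases h with h | h
      · exact .inl h
      · exact .inr ⟨l, by simp, (decide_eq_true_iff.1 h)⟩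
    · exact .inr ⟨l', List.mem_cons_of_mem _ hl', he⟩


end STPP222CubeNeg

end Summit.MatrixMultiplication.OmegaCensus
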